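import Mathlib
import HarnessLib
import Summits.Ventures.LatticeQCDFlow.Scaling.TiltKLDivergence
import Summits.Ventures.LatticeQCDFlow.Scaling.BregmanDiagonalLimit

/-!
# LatticeQCDFlow / Scaling — the TRAINING LOSSES ON THE DIAGONAL `β√n = c` and the
# LOSS–ACCEPTANCE DICTIONARY: reverse and forward loss `→ D = s/2`, ESS `→ e^{−2D}`,
# acceptance `→ erfc(√(D/2))`

HONEST FRAMING: exact (Metropolis-corrected) sampling algorithms for lattice gauge theory;
figures of merit are autocorrelation/cost numbers at stated couplings and volumes; no
continuum-physics claim.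

Venture `LatticeQCDFlow` (cell pub-lqcd), topic `Scaling`; FANOUT row 3 (`s0-u1-a`, S0-B
implementation A, GEN-20).  NEW WORK of the cell — assembly of row 3's `Scaling/TiltKLDivergence`
(the `n`-block losses in Mathlib's `klDiv` vocabulary), `Scaling/BregmanDiagonalLimit` (their
one-block limits), `Scaling/CumulantDiagonalLimit` (ESS fraction `→ e^{−s}`) and
`Scaling/IdentityFlowAcceptanceDiagonalLimit` (acceptance `→ erfc(|c|σ/2)`); NO definition is
introduced; nothing is cited.

## Content (all `[ours]`): `n` i.i.d. blocks of law `ν`, bounded measurable block statistic `g`,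
## proposal `ν^{⊗n}`, target `e^{βT}ν^{⊗n}/M(β)^n`, `T = Σᵢ g(xᵢ)`, `β = c/√n`

* **`tiltPi_revKL_diag_tendsto`** — the total REVERSE loss `KL(ν^{⊗n} ‖ target) → c²·Var g/2`;
* **`tiltPi_fwdKL_diag_tendsto`** — the total FORWARD loss `→ c²·Var g/2`;
* **`tiltedPi_transfer_revKL_diag_tendsto`** — TRANSFER: a factorised flow perfectly trained at `β₀`
  (proposal `ν_{β₀}^{⊗n}`) reused at `β₀ + c/√n` has reverse loss `→ c²·Var_{ν_{β₀}} g/2`, half the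
  log-variance `s` of `Scaling/TiltTransferDiagonalLimit`;
* **`tiltPi_loss_acceptance_dictionary`** — centred non-degenerate `g`, `c ≠ 0`, `D = c²σ²/2`:
  reverse loss `→ D` ∧ forward loss `→ D` ∧ Kish ESS fraction `→ e^{−2D}` ∧ equilibrium acceptance
  `→ (2/√π)∫_{√(D/2)}^∞ e^{−u²} du = erfc(√(D/2))`.

Reading (value-free): in the large-volume diagonal regime the four figures of merit of the exact
sampler are functions of ONE number, the limiting training loss `D` (nats per configuration): a
reverse-KL loss `D` is worth an acceptance `erfc(√(D/2))` and a Kish fraction `e^{−2D}` — for the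
untrained sampler and for coupling transfer of a trained factorised flow alike.
NOT CLAIMED: general coupling sequences `β_n√n → c` (sequel); trained flows other than exact tilts;
rates; any value at the cell's `(β, L)`; nothing re-scored.
-/

noncomputable section

namespace Summit.Ventures.LatticeQCDFlow.Theory2

open MeasureTheory ProbabilityTheory InformationTheory Filter Finset Real Set
open scoped Topology NNReal ENNReal

/-! ## §4 The sampler on the diagonal: losses, ESS and acceptance are functions of one number -/

section Sampler

open Literature.Probability.Distributions.PseudoMarginalNoise

variable {X : Type*} {mX : MeasurableSpace X} {ν : Measure X} [IsProbabilityMeasure ν] {g : X → ℝ}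

/-- **THE TOTAL REVERSE LOSS ON THE DIAGONAL**: the training loss
`KL(ν^{⊗n} ‖ e^{(c/√n)T}ν^{⊗n}/M^n) → c²·Var g/2 = s/2` for the untrained `n`-block sampler. [ours] -/
theorem tiltPi_revKL_diag_tendsto (hgm : Measurable g) {K : ℝ} (hK : ∀ x, |g x| ≤ K) (c : ℝ) :
    Tendsto (fun n : ℕ => (klDiv (Measure.pi fun _ : Fin n => ν)
        ((Measure.pi fun _ : Fin n => ν).tilted fun y => c / Real.sqrt n * ∑ i, g (y i))).toReal)
      atTop (𝓝 (c ^ 2 * Var[g; ν] / 2)) := by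
  have hgb : ∀ᵐ x ∂ν, g x ∈ Set.Icc (-K) K := ae_of_all _ fun x => abs_le.1 (hK x)
  refine (tendsto_nat_mul_revBregman_div_sqrt hgm.aemeasurable hgb c).congr fun n => ?_
  rw [toReal_klDiv_pi_tilted_right hgm hK]

/-- **THE TOTAL FORWARD LOSS ON THE DIAGONAL**: `KL(e^{(c/√n)T}ν^{⊗n}/M^n ‖ ν^{⊗n}) → c²·Var g/2`.
[ours] -/
theorem tiltPi_fwdKL_diag_tendsto (hgm : Measurable g) {K : ℝ} (hK : ∀ x, |g x| ≤ K) (c : ℝ) :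
    Tendsto (fun n : ℕ => (klDiv ((Measure.pi fun _ : Fin n => ν).tilted
        fun y => c / Real.sqrt n * ∑ i, g (y i)) (Measure.pi fun _ : Fin n => ν)).toReal)
      atTop (𝓝 (c ^ 2 * Var[g; ν] / 2)) := by
  have hgb : ∀ᵐ x ∂ν, g x ∈ Set.Icc (-K) K := ae_of_all _ fun x => abs_le.1 (hK x)
  refine (tendsto_nat_mul_fwdBregman_div_sqrt hgm.aemeasurable hgb c).congr fun n => ?_
  rw [toReal_klDiv_pi_tilted_left hgm hK]

/-- **THE TRANSFER LOSS ON THE DIAGONAL**: a factorised flow perfectly trained at `β₀` (proposal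
`ν_{β₀}^{⊗n}`, `ν_{β₀} = ν.tilted(β₀ g)`) reused at `β₀ + c/√n` has reverse loss
`→ c²·Var_{ν_{β₀}} g/2` — half the log-variance `s` of `Scaling/TiltTransferDiagonalLimit`. [ours] -/
theorem tiltedPi_transfer_revKL_diag_tendsto (hgm : Measurable g) {K : ℝ} (hK : ∀ x, |g x| ≤ K)
    (β₀ c : ℝ) :
    Tendsto (fun n : ℕ => (klDiv (Measure.pi fun _ : Fin n => ν.tilted fun x => β₀ * g x)
        ((Measure.pi fun _ : Fin n => ν.tilted fun x => β₀ * g x).tilted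
          fun y => c / Real.sqrt n * ∑ i, g (y i))).toReal)
      atTop (𝓝 (c ^ 2 * Var[g; ν.tilted fun x => β₀ * g x] / 2)) := by
  have hgb : ∀ᵐ x ∂ν, g x ∈ Set.Icc (-K) K := ae_of_all _ fun x => abs_le.1 (hK x)
  haveI : IsProbabilityMeasure (ν.tilted fun x => β₀ * g x) :=
    isProbabilityMeasure_tilted (integrable_exp_mul_of_mem_Icc hgm.aemeasurable hgb)
  exact tiltPi_revKL_diag_tendsto hgm hK c

/-- **THE LOSS–ACCEPTANCE DICTIONARY ON THE DIAGONAL.**  For the untrained `n`-block sampler of a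
bounded centred non-degenerate statistic at `β = c/√n` (`c ≠ 0`), with `D = c²σ²/2`: the reverse loss
`→ D`, the forward loss `→ D`, the Kish ESS fraction `→ e^{−2D}` and the equilibrium acceptance
`→ (2/√π)∫_{√(D/2)}^∞ e^{−u²} du = erfc(√(D/2))`.  [ours] -/
theorem tiltPi_loss_acceptance_dictionary (hgm : Measurable g) {K : ℝ} (hK : ∀ x, |g x| ≤ K)
    (h0 : ∫ x, g x ∂ν = 0) {c : ℝ} (hc : c ≠ 0) (hσ : Var[g; ν] ≠ 0) :
    Tendsto (fun n : ℕ => (klDiv (Measure.pi fun _ : Fin n => ν)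
        ((Measure.pi fun _ : Fin n => ν).tilted fun y => c / Real.sqrt n * ∑ i, g (y i))).toReal)
      atTop (𝓝 (c ^ 2 * Var[g; ν] / 2))
    ∧ Tendsto (fun n : ℕ => (klDiv ((Measure.pi fun _ : Fin n => ν).tilted
        fun y => c / Real.sqrt n * ∑ i, g (y i)) (Measure.pi fun _ : Fin n => ν)).toReal)
      atTop (𝓝 (c ^ 2 * Var[g; ν] / 2))
    ∧ Tendsto (fun n : ℕ => (mgf g ν (c / Real.sqrt n) ^ 2 / mgf g ν (2 * c / Real.sqrt n)) ^ n)
      atTop (𝓝 (Real.exp (-(2 * (c ^ 2 * Var[g; ν] / 2)))))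
    ∧ Tendsto (fun n : ℕ =>
        (∫ x, ∫ y, min (Real.exp (c / Real.sqrt n * ∑ i, g (x i)))
              (Real.exp (c / Real.sqrt n * ∑ i, g (y i)))
            ∂(Measure.pi fun _ : Fin n => ν) ∂(Measure.pi fun _ : Fin n => ν))
          / ∫ x, Real.exp (c / Real.sqrt n * ∑ i, g (x i)) ∂(Measure.pi fun _ : Fin n => ν))
      atTop (𝓝 (2 / Real.sqrt Real.pi
        * ∫ u in Ioi (Real.sqrt (c ^ 2 * Var[g; ν] / 2 / 2)), Real.exp (-u ^ 2))) := by
  have hgb : ∀ᵐ x ∂ν, g x ∈ Set.Icc (-K) K := ae_of_all _ fun x => abs_le.1 (hK x)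
  refine ⟨tiltPi_revKL_diag_tendsto hgm hK c, tiltPi_fwdKL_diag_tendsto hgm hK c, ?_, ?_⟩
  · rw [show 2 * (c ^ 2 * Var[g; ν] / 2) = c ^ 2 * Var[g; ν] by ring]
    exact tendsto_essFrac_diag hgm.aemeasurable hgb h0 c
  · have e : Real.sqrt (c ^ 2 * Var[g; ν] / 2 / 2) = Real.sqrt (c ^ 2 * Var[g; ν]) / 2 := by
      rw [div_div, show (2 : ℝ) * 2 = 2 ^ 2 by norm_num,
        Real.sqrt_div (mul_nonneg (sq_nonneg c) (variance_nonneg g ν)), Real.sqrt_sq zero_le_two]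
    rw [e]
    exact tiltPi_meanAccept_diag_tendsto_erfc hgm hK h0 hc hσ
end Sampler

end Summit.Ventures.LatticeQCDFlow.Theory2

end
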